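import Summits.QuantumAdvantage.QuantumAdvantage.Theorems.OddPrimeWalkZeroSumPairs

/-!
# Item stmt-QuantumAdvantage-24030 `FarAffinePairLaw` — the FAR-AFFINE PAIR LAW of the u-walk game (route OddPrimeWalk, support, rank 9)

Cell qa-qnc0; planner qa-qnc0-p2 g29 (ROUND-29 §4, THM 29-A(ii), asks P2-29b/c/d; settles ROUND-28 Q28-D at `θ < 1`);
prover qn-prover-3 g18.

THEOREM (`oddPrimeWalk_farAffinePairLaw`).  `p = 5` u-walk game `ringWinU c`: if across a separator `m` (both sides `≥ 64` bits)
every cut `g ≤ m` is `𝔽₂`-affine in the bits `≥ m` and every cut `g > m` is `𝔽₂`-affine in the bits `< m` (own-side dependence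
arbitrary; filed as vanishing `|S| = 2` subcube parities), then `#WIN ≤ (1 − 2⁻¹²)·2ⁿ`.  In fact `#LOSE ≥ (2^m−2)(2^{n−m}−2)/900`.

PROOF.  The planner's 81-point corollary `OddConfig.affine_exists_lose` (file `OddPrimeWalkOddConfigAffine`): any near zero-sum
class triples `(x_a, y_a, x_a ⊕ y_a) ⊂ A_a` and far ones `⊂ B_b` contain a LOST glued pair.  TWO PIGEONHOLES, triple version
(`cost(s) = Σ_b |bad_b(s)|/|B_b|` as in `OddPrimeWalkBlindPairLaw`):
(i) `tenth_le_sum_cost` — every near triple system has `Σ_slots cost ≥ 1/10`: otherwise each far class `B_b` has a zero-sum pair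
avoiding `Bad_b = ⋃_slots bad_b(slot)` (the pairs touching `Bad_b` number `≤ 3·|Bad_b|·|B_b| < |zsumB b|` by the cube count
`3|B_b|² ≤ 10|zsumB b|`), contradicting `affine_exists_lose`;
(ii) `card_lose_ge_of_triples` — minimise the triple cost on each near class; each slot of a zero-sum pair has `≤ |A_a|` partners, so
`|zsumA a|·min ≤ 3|A_a|·Σ_{A_a} cost`, and with `3|A_a|² ≤ 10|zsumA a|`: `#LOSE ≥ min|B_b|·Σ_s cost(s) ≥ (1/10)·min|A_a|·min|B_b|/10`.
§3 arithmetic (`farAffinePairLaw_card`): `min|A_a| ≥ (2^m−2)/3`, `min|B_b| ≥ (2^{n−m}−2)/3`, `m, n−m ≥ 64`.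
WHAT THIS IS NOT: instrument (permuted-local / far-parity readers, ≤ 1 far bit per cut); the method is intrinsically bounded-far-degree
(ROUND-29 §4.6) and does not touch the dense cruxes 23029/23109; separation NOT moved.
-/

namespace Summit.QuantumAdvantage.AdviceFreeQNC0.OddConfig

open Finset Classical

variable {n : ℕ}

section Game

variable {m c : ℕ} {y : Fin (n + 1) → (Fin n → Bool) → Bool}

/-- **First pigeonhole, triple version.**  Far-affine `A`-cuts, near-affine `B`-cuts, and the far zero-sum pair counts
`3|B_b|² ≤ 10|zsumB b|` ⇒ every near zero-sum triple system has total cost `≥ 1/10`: otherwise some `B`-class has all its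
zero-sum pairs touching the bad sets, which cover `≤ 3·|Bad|·|B_b|` pairs. -/
theorem tenth_le_sum_cost
    (hAffA : ∀ g : Fin (n + 1), g.val ≤ m → ∀ u : Fin n → Bool, ∀ i j : Fin n,
      ¬ i.val < m → ¬ j.val < m → i ≠ j → sq (y g) u (eV i) (eV j) = 0)
    (hAffB : ∀ g : Fin (n + 1), m < g.val → ∀ u : Fin n → Bool, ∀ i j : Fin n,
      i.val < m → j.val < m → i ≠ j → sq (y g) u (eV i) (eV j) = 0)
    (hBpos : ∀ b : Fin 3, 0 < (Bcl n m b.val).card)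
    (hBz : ∀ b : Fin 3, 3 * ((Bcl n m b.val).card : ℝ) ^ 2 ≤ 10 * ((zsumB n m b.val).card : ℝ))
    (xa ya : Fin 3 → Fin n → Bool) (hxa : ∀ a, xa a ∈ Acl n m a.val) (hya : ∀ a, ya a ∈ Acl n m a.val)
    (hxya : ∀ a, addV (xa a) (ya a) ∈ Acl n m a.val) :
    (1 / 10 : ℝ) ≤ ∑ i : Fin 3 × Fin 3, cost m c y (tri xa ya i) := by
  set Bad : Fin 3 → Finset (Fin n → Bool) :=
    fun b => univ.biUnion fun i : Fin 3 × Fin 3 => badB m c y b.val (tri xa ya i) with hBad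
  -- some `B`-class has no zero-sum pair avoiding its bad set
  have key : ∃ b : Fin 3, ∀ p ∈ zsumB n m b.val, p.1 ∉ Bad b → p.2 ∉ Bad b → addV p.1 p.2 ∈ Bad b := by
    by_contra h
    push Not at h
    choose q hq hq1 hq2 hq3 using h
    have hAset : ∀ a, ∀ s ∈ Acl n m a, ∀ k : Fin n, ¬ k.val < m → s k = false :=
      fun a s hs k hk => (mem_filter.mp (mem_filter.mp hs).1).2 k hk
    have hBset : ∀ b, ∀ t ∈ Bcl n m b, ∀ k : Fin n, k.val < m → t k = false :=
      fun b t ht k hk => (mem_filter.mp (mem_filter.mp ht).1).2 k hk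
    have hq' : ∀ b, (q b).1 ∈ Bcl n m b.val ∧ (q b).2 ∈ Bcl n m b.val ∧ addV (q b).1 (q b).2 ∈ Bcl n m b.val := by
      intro b
      have h := mem_filter.mp (hq b)
      exact ⟨(mem_product.mp h.1).1, (mem_product.mp h.1).2, h.2⟩
    obtain ⟨i, j, hlose⟩ := affine_exists_lose m c y hAffA hAffB xa ya (fun b => (q b).1) (fun b => (q b).2)
      (fun a k hk => hAset _ _ (hxa a) k hk) (fun a k hk => hAset _ _ (hya a) k hk)
      (fun b k hk => hBset _ _ (hq' b).1 k hk) (fun b k hk => hBset _ _ (hq' b).2.1 k hk)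
      (fun a => ⟨(mem_filter.mp (hxa a)).2, (mem_filter.mp (hya a)).2, (mem_filter.mp (hxya a)).2⟩)
      (fun b => ⟨(mem_filter.mp (hq' b).1).2, (mem_filter.mp (hq' b).2.1).2, (mem_filter.mp (hq' b).2.2).2⟩)
    have hmem := tri_pred (fun v => v ∈ Bcl n m j.1.val ∧ v ∉ Bad j.1) (fun b => (q b).1) (fun b => (q b).2) j
      ⟨(hq' j.1).1, hq1 j.1⟩ ⟨(hq' j.1).2.1, hq2 j.1⟩ ⟨(hq' j.1).2.2, hq3 j.1⟩
    have hnot : tri (fun b => (q b).1) (fun b => (q b).2) j ∉ badB m c y j.1.val (tri xa ya i) := by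
      intro hb
      exact hmem.2 (mem_biUnion.mpr ⟨i, mem_univ _, hb⟩)
    rw [badB, mem_filter, not_and, not_not] at hnot
    have hwin := hnot hmem.1
    rw [hlose] at hwin
    exact Bool.false_ne_true hwin
  obtain ⟨b, hb⟩ := key
  -- counting: every zero-sum pair of class `b` touches `Bad b`
  have hBb : (0 : ℝ) < (Bcl n m b.val).card := by exact_mod_cast hBpos b
  have hcover : (zsumB n m b.val).card ≤ 3 * ((Bad b).card * (Bcl n m b.val).card) := by
    have hsub : zsumB n m b.val ⊆
        ((zsumB n m b.val).filter fun p => p.1 ∈ Bad b) ∪ ((zsumB n m b.val).filter fun p => p.2 ∈ Bad b)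
          ∪ ((zsumB n m b.val).filter fun p => addV p.1 p.2 ∈ Bad b) := by
      intro p hp
      simp only [mem_union, mem_filter]
      by_cases h1 : p.1 ∈ Bad b
      · exact Or.inl (Or.inl ⟨hp, h1⟩)
      · by_cases h2 : p.2 ∈ Bad b
        · exact Or.inl (Or.inr ⟨hp, h2⟩)
        · exact Or.inr ⟨hp, hb p hp h1 h2⟩
    have hZ1 : ((zsumB n m b.val).filter fun p => p.1 ∈ Bad b).card ≤ (Bad b).card * (Bcl n m b.val).card := by
      rw [← card_product]
      refine card_le_card fun p hp => ?_
      have hp' := mem_filter.mp hp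
      exact mem_product.mpr ⟨hp'.2, (mem_product.mp (mem_filter.mp hp'.1).1).2⟩
    have hZ2 : ((zsumB n m b.val).filter fun p => p.2 ∈ Bad b).card ≤ (Bad b).card * (Bcl n m b.val).card := by
      rw [mul_comm, ← card_product]
      refine card_le_card fun p hp => ?_
      have hp' := mem_filter.mp hp
      exact mem_product.mpr ⟨(mem_product.mp (mem_filter.mp hp'.1).1).1, hp'.2⟩
    have hZ3 : ((zsumB n m b.val).filter fun p => addV p.1 p.2 ∈ Bad b).card
        ≤ (Bad b).card * (Bcl n m b.val).card := by
      rw [mul_comm, ← card_product]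
      refine card_le_card_of_injOn (fun p => (p.1, addV p.1 p.2)) ?_ ?_
      · intro p hp
        have hp' := mem_filter.mp (mem_coe.mp hp)
        exact mem_coe.mpr (mem_product.mpr ⟨(mem_product.mp (mem_filter.mp hp'.1).1).1, hp'.2⟩)
      · intro p _ p' _ he
        simp only [Prod.mk.injEq] at he
        obtain ⟨h1, h2⟩ := he
        refine Prod.ext h1 ?_
        have := congrArg (addV p.1) h2
        rwa [addV_addV_cancel, h1, addV_addV_cancel] at this
    calc (zsumB n m b.val).card ≤ _ := card_le_card hsub
      _ ≤ _ := card_union_le _ _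
      _ ≤ (((zsumB n m b.val).filter fun p => p.1 ∈ Bad b).card
            + ((zsumB n m b.val).filter fun p => p.2 ∈ Bad b).card)
            + ((zsumB n m b.val).filter fun p => addV p.1 p.2 ∈ Bad b).card :=
          Nat.add_le_add_right (card_union_le _ _) _
      _ ≤ 3 * ((Bad b).card * (Bcl n m b.val).card) := by omega
  have hBadle : (Bad b).card ≤ ∑ i : Fin 3 × Fin 3, (badB m c y b.val (tri xa ya i)).card := card_biUnion_le
  -- real arithmetic
  have h1 : 3 * ((Bcl n m b.val).card : ℝ) ^ 2 ≤ 30 * ((Bad b).card : ℝ) * (Bcl n m b.val).card := by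
    have hc : ((zsumB n m b.val).card : ℝ) ≤ 3 * (((Bad b).card : ℝ) * (Bcl n m b.val).card) := by
      exact_mod_cast hcover
    nlinarith [hBz b, hc]
  have h2 : ((Bcl n m b.val).card : ℝ) ≤ 10 * ((Bad b).card : ℝ) := by nlinarith [h1, hBb]
  have h3 : ((Bad b).card : ℝ) ≤ ∑ i : Fin 3 × Fin 3, ((badB m c y b.val (tri xa ya i)).card : ℝ) := by
    exact_mod_cast hBadle
  calc (1 / 10 : ℝ) ≤ ((Bad b).card : ℝ) / (Bcl n m b.val).card := by
        rw [div_le_div_iff₀ (by norm_num) hBb]; linarith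
    _ ≤ (∑ i : Fin 3 × Fin 3, ((badB m c y b.val (tri xa ya i)).card : ℝ)) / (Bcl n m b.val).card :=
        div_le_div_of_nonneg_right h3 hBb.le
    _ = ∑ i : Fin 3 × Fin 3, ((badB m c y b.val (tri xa ya i)).card : ℝ) / (Bcl n m b.val).card := by
        rw [sum_div]
    _ ≤ ∑ i : Fin 3 × Fin 3, cost m c y (tri xa ya i) := by
        refine sum_le_sum fun i _ => ?_
        exact single_le_sum (f := fun b' : Fin 3 =>
            ((badB m c y b'.val (tri xa ya i)).card : ℝ) / (Bcl n m b'.val).card)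
          (fun _ _ => div_nonneg (Nat.cast_nonneg _) (Nat.cast_nonneg _)) (mem_univ b)

/-- the number of lost inputs as an iterated sum over `A`-parts and `B`-classes. -/
theorem card_lose_eq_sum (m c : ℕ) (y : Fin (n + 1) → (Fin n → Bool) → Bool) :
    ((univ.filter fun u : Fin n → Bool => ¬ ringWinU c y u = true).card : ℝ)
      = ∑ s ∈ Aset n m, ∑ b : Fin 3, ((badB m c y b.val s).card : ℝ) := by
  rw [natCast_card_filter, sum_eq_sum_glue m]
  refine sum_congr rfl fun s _ => ?_
  rw [sum_Bset_eq_sum_Bcl m]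
  refine sum_congr rfl fun b _ => ?_
  rw [badB, natCast_card_filter]

/-- `MB · cost(s) ≤ Σ_b |bad_b(s)|` when every `B`-class has `≥ MB` members. -/
theorem mul_cost_le (hBpos : ∀ b : Fin 3, 0 < (Bcl n m b.val).card) {MB : ℝ}
    (hMB : ∀ b : Fin 3, MB ≤ (Bcl n m b.val).card) (s : Fin n → Bool) :
    MB * cost m c y s ≤ ∑ b : Fin 3, ((badB m c y b.val s).card : ℝ) := by
  rw [cost, mul_sum]
  refine sum_le_sum fun b _ => ?_
  have hBb : (0 : ℝ) < (Bcl n m b.val).card := by exact_mod_cast hBpos b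
  calc MB * (((badB m c y b.val s).card : ℝ) / (Bcl n m b.val).card)
      ≤ ((Bcl n m b.val).card : ℝ) * (((badB m c y b.val s).card : ℝ) / (Bcl n m b.val).card) :=
        mul_le_mul_of_nonneg_right (hMB b) (div_nonneg (Nat.cast_nonneg _) (Nat.cast_nonneg _))
    _ = ((badB m c y b.val s).card : ℝ) := mul_div_cancel₀ _ (ne_of_gt hBb)

/-- **Second pigeonhole, triple version (double count).**  If every near zero-sum triple system has total cost `≥ β`
and `3|A_a|² ≤ 10|zsumA a|`, then `#LOSE ≥ β·(min|A_a|)·(min|B_b|)/10`: minimise the triple cost on each class and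
compare with the class average (each slot of a zero-sum pair has `≤ |A_a|` partners). -/
theorem card_lose_ge_of_triples
    (hApos : ∀ a : Fin 3, 0 < (Acl n m a.val).card) (hBpos : ∀ b : Fin 3, 0 < (Bcl n m b.val).card)
    (hAz : ∀ a : Fin 3, 3 * ((Acl n m a.val).card : ℝ) ^ 2 ≤ 10 * ((zsumA n m a.val).card : ℝ))
    {β MA MB : ℝ} (hMA0 : 0 ≤ MA) (hMB0 : 0 ≤ MB)
    (hMA : ∀ a : Fin 3, MA ≤ (Acl n m a.val).card) (hMB : ∀ b : Fin 3, MB ≤ (Bcl n m b.val).card)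
    (hsys : ∀ xa ya : Fin 3 → Fin n → Bool, (∀ a, xa a ∈ Acl n m a.val) → (∀ a, ya a ∈ Acl n m a.val) →
      (∀ a, addV (xa a) (ya a) ∈ Acl n m a.val) → β ≤ ∑ i : Fin 3 × Fin 3, cost m c y (tri xa ya i)) :
    β * MA * MB / 10 ≤ ((univ.filter fun u : Fin n → Bool => ¬ ringWinU c y u = true).card : ℝ) := by
  set F : (Fin n → Bool) × (Fin n → Bool) → ℝ :=
    fun q => cost m c y q.1 + cost m c y q.2 + cost m c y (addV q.1 q.2) with hF
  have hZpos : ∀ a : Fin 3, (zsumA n m a.val).Nonempty := by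
    intro a
    apply card_pos.mp
    have hA : (0 : ℝ) < (Acl n m a.val).card := by exact_mod_cast hApos a
    have h : (0 : ℝ) < ((zsumA n m a.val).card : ℝ) := by nlinarith [hAz a]
    exact_mod_cast h
  have hmin : ∀ a : Fin 3, ∃ q ∈ zsumA n m a.val, ∀ q' ∈ zsumA n m a.val, F q ≤ F q' :=
    fun a => exists_min_image _ F (hZpos a)
  choose p hp hpmin using hmin
  have hp' : ∀ a, (p a).1 ∈ Acl n m a.val ∧ (p a).2 ∈ Acl n m a.val ∧ addV (p a).1 (p a).2 ∈ Acl n m a.val := by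
    intro a
    have h := mem_filter.mp (hp a)
    exact ⟨(mem_product.mp h.1).1, (mem_product.mp h.1).2, h.2⟩
  -- the minimisers form a system: `β ≤ Σ_a F (p a)`
  have hβ : β ≤ ∑ a : Fin 3, F (p a) := by
    have h := hsys (fun a => (p a).1) (fun a => (p a).2) (fun a => (hp' a).1) (fun a => (hp' a).2.1)
      (fun a => (hp' a).2.2)
    rwa [sum_tri] at h
  -- class sums of the cost
  set S : Fin 3 → ℝ := fun a => ∑ s ∈ Acl n m a.val, cost m c y s with hS
  have hslot : ∀ a : Fin 3, ((zsumA n m a.val).card : ℝ) * F (p a) ≤ 3 * ((Acl n m a.val).card : ℝ) * S a := by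
    intro a
    have hsum : ((zsumA n m a.val).card : ℝ) * F (p a) ≤ ∑ q ∈ zsumA n m a.val, F q := by
      calc ((zsumA n m a.val).card : ℝ) * F (p a) = ∑ _q ∈ zsumA n m a.val, F (p a) := by
            rw [sum_const, nsmul_eq_mul]
        _ ≤ ∑ q ∈ zsumA n m a.val, F q := sum_le_sum fun q hq => hpmin a q hq
    have hsub : zsumA n m a.val ⊆ (Acl n m a.val) ×ˢ (Acl n m a.val) := filter_subset _ _
    have hnn : ∀ s, 0 ≤ cost m c y s := cost_nonneg m c y
    have e1 : (∑ q ∈ zsumA n m a.val, cost m c y q.1) ≤ ((Acl n m a.val).card : ℝ) * S a := by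
      calc (∑ q ∈ zsumA n m a.val, cost m c y q.1)
          ≤ ∑ q ∈ (Acl n m a.val) ×ˢ (Acl n m a.val), cost m c y q.1 :=
            sum_le_sum_of_subset_of_nonneg hsub fun q _ _ => hnn q.1
        _ = ((Acl n m a.val).card : ℝ) * S a := by
            rw [sum_product, hS]
            simp only [sum_const, nsmul_eq_mul]
            rw [mul_sum]
    have e2 : (∑ q ∈ zsumA n m a.val, cost m c y q.2) ≤ ((Acl n m a.val).card : ℝ) * S a := by
      calc (∑ q ∈ zsumA n m a.val, cost m c y q.2)
          ≤ ∑ q ∈ (Acl n m a.val) ×ˢ (Acl n m a.val), cost m c y q.2 :=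
            sum_le_sum_of_subset_of_nonneg hsub fun q _ _ => hnn q.2
        _ = ((Acl n m a.val).card : ℝ) * S a := by
            rw [sum_product_right, hS]
            simp only [sum_const, nsmul_eq_mul]
            rw [mul_sum]
    have e3 : (∑ q ∈ zsumA n m a.val, cost m c y (addV q.1 q.2)) ≤ ((Acl n m a.val).card : ℝ) * S a := by
      have hinj : Set.InjOn (fun q : (Fin n → Bool) × (Fin n → Bool) => (q.1, addV q.1 q.2))
          (zsumA n m a.val : Set ((Fin n → Bool) × (Fin n → Bool))) := by
        intro q _ q' _ he
        simp only [Prod.mk.injEq] at he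
        obtain ⟨h1, h2⟩ := he
        refine Prod.ext h1 ?_
        have := congrArg (addV q.1) h2
        rwa [addV_addV_cancel, h1, addV_addV_cancel] at this
      have himg : (zsumA n m a.val).image (fun q => (q.1, addV q.1 q.2)) ⊆ (Acl n m a.val) ×ˢ (Acl n m a.val) := by
        intro q hq
        obtain ⟨q₀, hq₀, rfl⟩ := mem_image.mp hq
        have h := mem_filter.mp hq₀
        exact mem_product.mpr ⟨(mem_product.mp h.1).1, h.2⟩
      calc (∑ q ∈ zsumA n m a.val, cost m c y (addV q.1 q.2))
          = ∑ q ∈ (zsumA n m a.val).image (fun q => (q.1, addV q.1 q.2)), cost m c y q.2 := by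
            rw [sum_image hinj]
        _ ≤ ∑ q ∈ (Acl n m a.val) ×ˢ (Acl n m a.val), cost m c y q.2 :=
            sum_le_sum_of_subset_of_nonneg himg fun q _ _ => hnn q.2
        _ = ((Acl n m a.val).card : ℝ) * S a := by
            rw [sum_product_right, hS]
            simp only [sum_const, nsmul_eq_mul]
            rw [mul_sum]
    have hFsum : (∑ q ∈ zsumA n m a.val, F q) = (∑ q ∈ zsumA n m a.val, cost m c y q.1)
        + (∑ q ∈ zsumA n m a.val, cost m c y q.2) + ∑ q ∈ zsumA n m a.val, cost m c y (addV q.1 q.2) := by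
      rw [hF]; simp only [sum_add_distrib]
    linarith
  -- per class: `MA · F (p a) ≤ 10 · S a`
  have hFnn : ∀ a, 0 ≤ F (p a) := fun a =>
    add_nonneg (add_nonneg (cost_nonneg m c y _) (cost_nonneg m c y _)) (cost_nonneg m c y _)
  have hcls : ∀ a : Fin 3, MA * F (p a) ≤ 10 * S a := by
    intro a
    have hA : (0 : ℝ) < (Acl n m a.val).card := by exact_mod_cast hApos a
    have h1 : ((Acl n m a.val).card : ℝ) * F (p a) ≤ 10 * S a := by
      -- from `3A²·F ≤ 10|Z|·F ≤ 30·A·S`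
      have h2 : 3 * ((Acl n m a.val).card : ℝ) ^ 2 * F (p a) ≤ 30 * ((Acl n m a.val).card : ℝ) * S a := by
        nlinarith [hAz a, hslot a, hFnn a]
      nlinarith [h2, hA]
    calc MA * F (p a) ≤ ((Acl n m a.val).card : ℝ) * F (p a) := mul_le_mul_of_nonneg_right (hMA a) (hFnn a)
      _ ≤ 10 * S a := h1
  have hSsum : (∑ a : Fin 3, S a) = ∑ s ∈ Aset n m, cost m c y s := by rw [hS, ← sum_Aset_eq_sum_Acl]
  have hMAβ : MA * β ≤ 10 * ∑ s ∈ Aset n m, cost m c y s := by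
    calc MA * β ≤ MA * ∑ a : Fin 3, F (p a) := mul_le_mul_of_nonneg_left hβ hMA0
      _ = ∑ a : Fin 3, MA * F (p a) := by rw [mul_sum]
      _ ≤ ∑ a : Fin 3, 10 * S a := sum_le_sum fun a _ => hcls a
      _ = 10 * ∑ s ∈ Aset n m, cost m c y s := by rw [← mul_sum, hSsum]
  have hL : MB * ∑ s ∈ Aset n m, cost m c y s
      ≤ ((univ.filter fun u : Fin n → Bool => ¬ ringWinU c y u = true).card : ℝ) := by
    rw [card_lose_eq_sum m c y, mul_sum]
    exact sum_le_sum fun s _ => mul_cost_le hBpos hMB s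
  calc β * MA * MB / 10 = MB * (MA * β) / 10 := by ring
    _ ≤ MB * (10 * ∑ s ∈ Aset n m, cost m c y s) / 10 := by
        refine div_le_div_of_nonneg_right (mul_le_mul_of_nonneg_left hMAβ hMB0) (by norm_num)
    _ = MB * ∑ s ∈ Aset n m, cost m c y s := by ring
    _ ≤ _ := hL

end Game

/-! ### §3 The far-affine pair law -/

/-- **FAR-AFFINE PAIR LAW** (item stmt-QuantumAdvantage-24030, engine form): both sides `≥ 64` bits, `A`-cuts affine in the
far bits and `B`-cuts affine in the near bits (filed `|S| = 2` form) ⇒ `#WIN ≤ (1 - 2^{-12})·2^n`. -/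
theorem farAffinePairLaw_card (n m c : ℕ) (y : Fin (n + 1) → (Fin n → Bool) → Bool)
    (hm : 64 ≤ m) (hmn : m + 64 ≤ n)
    (hfarA : ∀ g : Fin (n + 1), g.val ≤ m → ∀ u : Fin n → Bool, ∀ S : Finset (Fin n), S.card = 2 →
      (∀ i ∈ S, m ≤ i.val) →
      (S.powerset.filter fun T => y g (fun i => Bool.xor (u i) (decide (i ∈ T))) = true).card % 2 = 0)
    (hfarB : ∀ g : Fin (n + 1), m < g.val → ∀ u : Fin n → Bool, ∀ S : Finset (Fin n), S.card = 2 →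
      (∀ i ∈ S, i.val < m) →
      (S.powerset.filter fun T => y g (fun i => Bool.xor (u i) (decide (i ∈ T))) = true).card % 2 = 0) :
    ((univ.filter fun u : Fin n → Bool => ringWinU c y u = true).card : ℝ)
      ≤ (1 - (2 : ℝ)⁻¹ ^ 12) * (2 : ℝ) ^ n := by
  have hAffA := hAffA_of_filed m y hfarA
  have hAffB := hAffB_of_filed m y hfarB
  have hmn' : m ≤ n := by omega
  have hk : 64 ≤ n - m := by omega
  -- class sizes and positivity
  have hAcard : ∀ a : Fin 3, 2 ^ m ≤ 3 * (Acl n m a.val).card + 2 := fun a => pow_le_card_Acl hmn' a.isLt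
  have hBcard : ∀ b : Fin 3, 2 ^ (n - m) ≤ 3 * (Bcl n m b.val).card + 2 := fun b => pow_le_card_Bcl hmn' b.isLt
  have h64m : 2 ^ 64 ≤ 2 ^ m := Nat.pow_le_pow_right (by norm_num) hm
  have h64k : 2 ^ 64 ≤ 2 ^ (n - m) := Nat.pow_le_pow_right (by norm_num) hk
  have hApos : ∀ a : Fin 3, 0 < (Acl n m a.val).card := fun a => by have := hAcard a; omega
  have hBpos : ∀ b : Fin 3, 0 < (Bcl n m b.val).card := fun b => by have := hBcard b; omega
  -- zero-sum pair counts, transported from the cubes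
  have hAz : ∀ a : Fin 3, 3 * ((Acl n m a.val).card : ℝ) ^ 2 ≤ 10 * ((zsumA n m a.val).card : ℝ) := by
    intro a
    rw [card_zsumA hmn', card_Acl hmn']
    exact three_mul_sq_card_cls_le hm a.isLt
  have hBz : ∀ b : Fin 3, 3 * ((Bcl n m b.val).card : ℝ) ^ 2 ≤ 10 * ((zsumB n m b.val).card : ℝ) := by
    intro b
    rw [card_zsumB hmn', card_Bcl hmn']
    exact three_mul_sq_card_cls_le hk b.isLt
  set X : ℝ := (2 : ℝ) ^ m with hX
  set Y : ℝ := (2 : ℝ) ^ (n - m) with hY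
  have hX2 : (2 : ℝ) ^ 64 ≤ X := by rw [hX]; exact_mod_cast h64m
  have hY2 : (2 : ℝ) ^ 64 ≤ Y := by rw [hY]; exact_mod_cast h64k
  have hMA : ∀ a : Fin 3, (X - 2) / 3 ≤ ((Acl n m a.val).card : ℝ) := by
    intro a
    have h : (2 : ℝ) ^ m ≤ 3 * ((Acl n m a.val).card : ℝ) + 2 := by exact_mod_cast hAcard a
    rw [hX]; linarith
  have hMB : ∀ b : Fin 3, (Y - 2) / 3 ≤ ((Bcl n m b.val).card : ℝ) := by
    intro b
    have h : (2 : ℝ) ^ (n - m) ≤ 3 * ((Bcl n m b.val).card : ℝ) + 2 := by exact_mod_cast hBcard b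
    rw [hY]; linarith
  have hlose := card_lose_ge_of_triples (c := c) hApos hBpos hAz (β := 1 / 10) (MA := (X - 2) / 3) (MB := (Y - 2) / 3)
    (by norm_num at hX2 ⊢; linarith) (by norm_num at hY2 ⊢; linarith) hMA hMB
    (fun xa ya hxa hya hxya => tenth_le_sum_cost hAffA hAffB hBpos hBz xa ya hxa hya hxya)
  -- #WIN + #LOSE = 2^n
  have htot : ((univ.filter fun u : Fin n → Bool => ringWinU c y u = true).card : ℝ)
      + ((univ.filter fun u : Fin n → Bool => ¬ ringWinU c y u = true).card : ℝ) = (2 : ℝ) ^ n := by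
    have h := card_filter_add_card_filter_not (s := (univ : Finset (Fin n → Bool)))
      (fun u : Fin n → Bool => ringWinU c y u = true)
    rw [card_univ, Fintype.card_fun, Fintype.card_bool, Fintype.card_fin] at h
    exact_mod_cast h
  have hXY : X * Y = (2 : ℝ) ^ n := by
    rw [hX, hY, ← pow_add]; congr 1; omega
  have h12 : (2 : ℝ)⁻¹ ^ 12 = 1 / 4096 := by norm_num
  rw [h12, ← hXY]
  have hXY1 : 8192 * X ≤ X * Y := by nlinarith [hX2, hY2]
  have hXY2 : 8192 * Y ≤ X * Y := by nlinarith [hX2, hY2]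
  nlinarith [hlose, htot, hXY1, hXY2, hXY]

end Summit.QuantumAdvantage.AdviceFreeQNC0.OddConfig

namespace Summit.QuantumAdvantage.QuantumAdvantage.Theorems

set_option linter.dupNamespace false

/-- **Item stmt-QuantumAdvantage-24030 `FarAffinePairLaw` (route OddPrimeWalk, support, rank 9; planner qa-qnc0-p2 g29 ROUND-29 §4,
THM 29-A(ii); prover qn-prover-3 g18).**  In the `p = 5` u-walk game `ringWinU c`: if across a separator `m` (both sides `≥ 64`
bits) every cut `g ≤ m` is `𝔽₂`-affine in the bits `≥ m` and every cut `g > m` is `𝔽₂`-affine in the bits `< m` (own side arbitrary),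
then `#WIN ≤ (1 − 2⁻¹²)·2ⁿ`. -/
theorem oddPrimeWalk_farAffinePairLaw : Summit.QuantumAdvantage.QuantumAdvantage.Theses.OddPrimeWalk.FarAffinePairLaw := by
  intro n m c y hm hmn hA hB
  exact Summit.QuantumAdvantage.AdviceFreeQNC0.OddConfig.farAffinePairLaw_card n m c y hm hmn hA hB

end Summit.QuantumAdvantage.QuantumAdvantage.Theorems
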